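import Summits.CriticalPhenomena.PercolationContinuityZ3.Theorems.PercAnnulusCrossingSetToSetQuasiMultReduction
import Summits.CriticalPhenomena.PercolationContinuityZ3.Theorems.PercAnnulusCrossingSetToSetBridge
import HarnessLib

/-!
# The (A2) chain read through the lane's definitions `Crossing.SetToSetQuasiMultAt` / `SetToSetQuasiMult` (defs v3) — lane RSW3, seat p1 gen 2

builds on p205010 (kernel theorem, internal audit signed; external expert review pending)

Cell `prim-rsw3`, seat `prim-rsw3-p1` (gen 2; file drafted by p1 gen 2, landed unchanged by the lead gen 3).  Memo `run/shared/lean/prim/rsw3/P1-QM.md` §11.  Support file; no definitions, no sorries.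
The reduction files state Basu–Sapozhnikov's (A2) in box form written out; the lead's defs v3 (`PercAnnulusCrossingBoxCrossingDefs.lean`)
names it `Crossing.SetToSetQuasiMultAt d p ϰ` (with `ϰ · (P·P)` bracketing) and `Crossing.SetToSetQuasiMult` (`∃ ϰ > 0` at `p_c(ℤ³)`).  Here:

(`SetToSetQuasiMult ⇒ OneArmQuasiMult ∧ OneArmDoubling` is the lead's `PercAnnulusCrossingSetToSetBridge.lean`.)
* `setToSetQuasiMultAt_of_setToSetQM'` — the crossed-spheres form (A2′)(c) at `p_c(ℤ^d)`, `d ≥ 2`, gives `SetToSetQuasiMultAt d p_c (c²·w_d)`;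
* `setToSetQuasiMult_of_condAnnulusUniq` — conditional annulus-uniqueness with constant `c > 0` at `p_c(ℤ³)` gives `SetToSetQuasiMult`
  (hence, by Basu–Sapozhnikov's Thm 1.1 — printed, not in the tree — Kesten's IIC on `ℤ³`).

References: D. Basu, A. Sapozhnikov, ECP 22 (2017) no. 26, §1 (A2), Thm 1.1, §3 (13)–(14).
-/

noncomputable section

namespace Summit.CriticalPhenomena.PercolationContinuityZ3.Theorems.Crossing

open MeasureTheory Literature.Probability.Percolation Literature.Probability.LatticeModels

variable {d : ℕ}

/-- **(A2′)(c) at `p_c(ℤ^d)`, `d ≥ 2` ⇒ `SetToSetQuasiMultAt d p_c (c² · (2d)⁻¹ · 12^{−(d−1)})`** (`setToSetQM_of_setToSetQM'` read through the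
definition). [cite: BasuSapozhnikov2017ECP, §3 eqs. (13)–(14)] -/
theorem setToSetQuasiMultAt_of_setToSetQM' (hd : 2 ≤ d) {c : ℝ} (hc : 0 ≤ c)
    (hA2' : ∀ a b : ℕ, 1 ≤ a → a < b → b ≤ 2 * a → ∀ Z : Finset (Site d), box d b \ box d (a - 1) ⊆ Z →
      ∀ X : Finset (Site d), X ⊆ Z ∩ box d a → ∀ Y : Finset (Site d), Y ⊆ Z \ box d b →
        c * (bondPercolation (zdGraph d) (criticalProbI d)).real
              {ω | ∃ x ∈ X, ∃ s ∈ innerBoundary (zdGraph d) (box d b), ω ∈ openConnIn (↑Z : Set (Site d)) x s} *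
            (bondPercolation (zdGraph d) (criticalProbI d)).real
              {ω | ∃ y ∈ Y, ∃ s ∈ innerBoundary (zdGraph d) (box d a), ω ∈ openConnIn (↑Z : Set (Site d)) y s} ≤
          (bondPercolation (zdGraph d) (criticalProbI d)).real
            {ω | ∃ x ∈ X, ∃ y ∈ Y, ω ∈ openConnIn (↑Z : Set (Site d)) x y}) :
    SetToSetQuasiMultAt d (criticalProbI d) (c ^ 2 * ((2 * (d : ℝ))⁻¹ * ((1 : ℝ) / 12) ^ (d - 1))) :=
  fun m hm Z hZ X hX Y hY => setToSetQM_of_setToSetQM' hd hc hA2' m hm Z hZ X hX Y hY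

/-- **Conditional annulus-uniqueness with constant `c > 0` at `p_c(ℤ³)` ⇒ `SetToSetQuasiMult`** — with Basu–Sapozhnikov's Thm 1.1 (printed)
this is a sufficient condition for Kesten's IIC on `ℤ³`; its full-box instance is census question Q15 (c_U ≈ 0.46/0.75/0.90 at aspects 8/16/32,
ttrl CU-Q15, non-rigorous). [cite: BasuSapozhnikov2017ECP, §1 (comments on (A2)) and Thm. 1.1] -/
theorem setToSetQuasiMult_of_condAnnulusUniq {c : ℝ} (hc : 0 < c)
    (hCU : ∀ a b : ℕ, 1 ≤ a → a < b → b ≤ 2 * a → ∀ Z : Finset (Site 3), box 3 b \ box 3 (a - 1) ⊆ Z →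
      ∀ X : Finset (Site 3), X ⊆ Z ∩ box 3 a → ∀ Y : Finset (Site 3), Y ⊆ Z \ box 3 b →
        c * (bondPercolation (zdGraph 3) (criticalProbI 3)).real
            ({ω | ∃ x ∈ X, ∃ s ∈ innerBoundary (zdGraph 3) (box 3 b), ω ∈ openConnIn (↑Z : Set (Site 3)) x s} ∩
             {ω | ∃ y ∈ Y, ∃ s ∈ innerBoundary (zdGraph 3) (box 3 a), ω ∈ openConnIn (↑Z : Set (Site 3)) y s}) ≤
          (bondPercolation (zdGraph 3) (criticalProbI 3)).real
            ({ω | ∃ x ∈ X, ∃ s ∈ innerBoundary (zdGraph 3) (box 3 b), ω ∈ openConnIn (↑Z : Set (Site 3)) x s} ∩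
             {ω | ∃ y ∈ Y, ∃ s ∈ innerBoundary (zdGraph 3) (box 3 a), ω ∈ openConnIn (↑Z : Set (Site 3)) y s} ∩
             {ω | ∀ t ∈ innerBoundary (zdGraph 3) (box 3 a), ∀ s ∈ innerBoundary (zdGraph 3) (box 3 b),
                ∀ t' ∈ innerBoundary (zdGraph 3) (box 3 a), ∀ s' ∈ innerBoundary (zdGraph 3) (box 3 b),
                ω ∈ openConnIn (↑((box 3 b \ box 3 a) ∪ innerBoundary (zdGraph 3) (box 3 a)) : Set (Site 3)) t s →
                ω ∈ openConnIn (↑((box 3 b \ box 3 a) ∪ innerBoundary (zdGraph 3) (box 3 a)) : Set (Site 3)) t' s' →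
                ω ∈ openConnIn (↑((box 3 b \ box 3 a) ∪ innerBoundary (zdGraph 3) (box 3 a)) : Set (Site 3)) s s'})) :
    SetToSetQuasiMult := by
  refine ⟨c ^ 2 * ((2 * ((3 : ℕ) : ℝ))⁻¹ * ((1 : ℝ) / 12) ^ (3 - 1)), by positivity, ?_⟩
  exact setToSetQuasiMultAt_of_setToSetQM' (d := 3) (by norm_num) hc.le
    (setToSetQM'_of_condAnnulusUniq (criticalProbI 3) hc.le hCU)

end Summit.CriticalPhenomena.PercolationContinuityZ3.Theorems.Crossing

end
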